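import Mathlib
import Literature.MathematicalPhysics.QuantumLattice.WilsonDiracAP
import Summits.QuantumFields.QCD.Theses.WilsonQuarkChessboard
import Summits.QuantumFields.QCD.Theorems.WilsonQuarkChessboardBackgroundSchwarzFinal
import Summits.QuantumFields.QCD.Theorems.WilsonQuarkChessboardBackgroundSchwarzIndex

/-!
# The background Schwarz inequality for the antiperiodic Wilson determinant
(helper for crux stmt-QuantumFields-9734, line `Sketch`, stub `stub_backgroundSchwarz`;
the statement is item stmt-QuantumFields-10349, `Theses.WilsonQuarkChessboard.BackgroundSchwarz`)

What.  For every `N`, every even side `L ≥ 4`, every `U(N)` link field `U` on the four-torus and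
every Wilson bare mass `m > -1` (`r = 1`): with `det_AP[V]` the determinant of the Wilson–Dirac
matrix of the all-axes antiperiodically twisted field, `Θ` the site reflection `x₀ ↦ -x₀` on link
fields and `H` the closed positive half of the links, the doubles `U⁺⁺ = (H ? U : ΘU)` and
`U⁻⁻ = (H ? ΘU : U)` have real non-negative `det_AP`, and
`‖det_AP[U]‖² ≤ Re det_AP[U⁺⁺] · Re det_AP[U⁻⁻]` (Lüscher 1977; Osterwalder–Seiler 1978 §2;
Montvay–Münster §4.2.3, (4.99)–(4.111)).

How.  Pure glue over the landed helper files `…WilsonQuarkChessboardBackgroundSchwarz*`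
(namespace `Summit.QuantumFields.QCD.Theorems.BackgroundSchwarz`), whose final theorem
`schwarz_reindexed` is exactly this inequality for the determinants of the REINDEXED (`Emb`,
Lüscher's `ξ/η` split at the planes `x₀ = 0, L/2`, `L = 2K + 4`) ROTATED (`γ₀`-diagonal spin basis,
`rotD`) twisted Wilson–Dirac matrices, with the doubles given pointwise (`posE`, `Θcfg`).  We undo
the reindexing by `Matrix.det_submatrix_equiv_self` along `Equiv.ofBijective Emb (emb_bijective hK)`
and the rotation by `det_wilsonDirac_eq_det_rot`, write `L = 2K + 4` from `Even L ∧ 4 ≤ L`, and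
observe that the item's inlined `let`s ARE the scoped notations `apTw`, `Θcfg`, `posE` of the helper
files (the four pointwise hypotheses are `if_pos` / `if_neg`).  No definitions, no new notation.
-/

noncomputable section

open scoped BigOperators Matrix ComplexConjugate
open Finset
open Literature.MathematicalPhysics.QuantumLattice Literature.MathematicalPhysics.QuantumFieldTheory
  Literature.Probability.LatticeModels

namespace Summit.QuantumFields.QCD.Theorems.BackgroundSchwarz

variable {L N : ℕ} [NeZero L] {K : ℕ}

/-- Transport of the five-part Schwarz conclusion along three equalities of complex numbers. -/
theorem schwarz_transfer {a b c a' b' c' : ℂ} (ha : a = a') (hb : b = b') (hc : c = c')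
    (h : 0 ≤ b.re ∧ b.im = 0 ∧ 0 ≤ c.re ∧ c.im = 0 ∧ ‖a‖ ^ 2 ≤ b.re * c.re) :
    0 ≤ b'.re ∧ b'.im = 0 ∧ 0 ≤ c'.re ∧ c'.im = 0 ∧ ‖a'‖ ^ 2 ≤ b'.re * c'.re := by
  subst ha hb hc
  exact h

/-- The determinant of a square matrix is unchanged by reindexing rows and columns along the same
bijection (`Matrix.det_submatrix_equiv_self` for `Equiv.ofBijective`).  The `Fintype`/`DecidableEq`
instances are implicit (assigned by unification at the use site, where the reindexing type
`(ι ⊕ ι) ⊕ (β ⊕ β)` is too large for the default instance search). -/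
theorem det_submatrix_of_bijective {ι κ R : Type*} {_ : Fintype ι} {_ : DecidableEq ι}
    {_ : Fintype κ} {_ : DecidableEq κ} [CommRing R] (A : Matrix κ κ R) (f : ι → κ)
    (hf : Function.Bijective f) : (A.submatrix f f).det = A.det :=
  Matrix.det_submatrix_equiv_self (Equiv.ofBijective f hf) A

/-- **The background Schwarz inequality for the twisted Wilson–Dirac determinants** (`L = 2K + 4`,
`m > -1`, doubles `U⁺⁺`, `U⁻⁻` given pointwise): `schwarz_reindexed` with the reindexing `Emb`
removed (`emb_bijective`) and the spin rotation removed (`det_wilsonDirac_eq_det_rot`). -/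
theorem schwarz_wilsonDirac (hK : L = 2 * K + 4)
    (U Upp Umm : GaugeConfig 4 L (Matrix.unitaryGroup (Fin N) ℂ)) (m : ℝ) (hm : -1 < m)
    (hUpp_pos : ∀ e : Edge 4 L, posE[L, e] → Upp e = U e)
    (hUpp_neg : ∀ e : Edge 4 L, ¬posE[L, e] → Upp e = Θcfg[U] e)
    (hUmm_pos : ∀ e : Edge 4 L, posE[L, e] → Umm e = Θcfg[U] e)
    (hUmm_neg : ∀ e : Edge 4 L, ¬posE[L, e] → Umm e = U e) :
    0 ≤ ((wilsonDirac (unitaryFundamentalRep (Fin N) ℂ) (apTw[L, Upp]) m 1).det).re ∧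
    ((wilsonDirac (unitaryFundamentalRep (Fin N) ℂ) (apTw[L, Upp]) m 1).det).im = 0 ∧
    0 ≤ ((wilsonDirac (unitaryFundamentalRep (Fin N) ℂ) (apTw[L, Umm]) m 1).det).re ∧
    ((wilsonDirac (unitaryFundamentalRep (Fin N) ℂ) (apTw[L, Umm]) m 1).det).im = 0 ∧
    ‖(wilsonDirac (unitaryFundamentalRep (Fin N) ℂ) (apTw[L, U]) m 1).det‖ ^ 2 ≤
      ((wilsonDirac (unitaryFundamentalRep (Fin N) ℂ) (apTw[L, Upp]) m 1).det).re *
        ((wilsonDirac (unitaryFundamentalRep (Fin N) ℂ) (apTw[L, Umm]) m 1).det).re :=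
  schwarz_transfer
    ((det_submatrix_of_bijective _ _ (emb_bijective hK)).trans
      (det_wilsonDirac_eq_det_rot (unitaryFundamentalRep (Fin N) ℂ) (apTw[L, U]) m).symm)
    ((det_submatrix_of_bijective _ _ (emb_bijective hK)).trans
      (det_wilsonDirac_eq_det_rot (unitaryFundamentalRep (Fin N) ℂ) (apTw[L, Upp]) m).symm)
    ((det_submatrix_of_bijective _ _ (emb_bijective hK)).trans
      (det_wilsonDirac_eq_det_rot (unitaryFundamentalRep (Fin N) ℂ) (apTw[L, Umm]) m).symm)
    (schwarz_reindexed hK U Upp Umm m hm hUpp_pos hUpp_neg hUmm_pos hUmm_neg)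

omit [NeZero L] in
/-- An even `L ≥ 4` is `2K + 4`. -/
theorem exists_eq_two_mul_add_four (hE : Even L) (h4 : 4 ≤ L) : ∃ K : ℕ, L = 2 * K + 4 := by
  obtain ⟨t, ht⟩ := hE
  exact ⟨t - 2, by omega⟩

end Summit.QuantumFields.QCD.Theorems.BackgroundSchwarz

namespace Summit.QuantumFields.QCD.Cruxes.CriticalLineDiamagnetism.ChessboardCellGain

open Summit.QuantumFields.QCD.Theorems.BackgroundSchwarz in
/-- **Stub 1a — `backgroundSchwarz`** (= item stmt-QuantumFields-10349 of the sibling route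
`WilsonQuarkChessboard`): Lüscher/Osterwalder–Seiler site-reflection positivity of the antiperiodic
`r = 1` Wilson determinant in a `U(N)` background, Cauchy–Schwarz form, time axis, planes `0 | L/2`,
for all `N`, all even `L ≥ 4` and `m > -1`.  The item's inlined `let`s `dAP`, `Θ`, `pos` are
literally `V ↦ det (wilsonDirac ρ₀ apTw[L, V] m 1)`, `Θcfg`, `posE`; its doubles `Upp`/`Umm` satisfy
the four pointwise hypotheses of `schwarz_wilsonDirac` by `if_pos`/`if_neg`. -/
theorem stub_backgroundSchwarz : Theses.WilsonQuarkChessboard.BackgroundSchwarz := by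
  intro N L _ hEven h4 U m hm
  obtain ⟨K, hK⟩ := exists_eq_two_mul_add_four hEven h4
  intro dAP θ Θ pos Upp Umm
  exact schwarz_wilsonDirac hK U Upp Umm m hm (fun _ he => if_pos he) (fun _ he => if_neg he)
    (fun _ he => if_pos he) (fun _ he => if_neg he)

end Summit.QuantumFields.QCD.Cruxes.CriticalLineDiamagnetism.ChessboardCellGain

end
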